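import Literature.Combinatorics.HalesJewett.DKTCorrelation
import Literature.Combinatorics.HalesJewett.DKTGrahamRothschildProof
import HarnessLib

/-!
# Density Hales–Jewett: tiling by subspaces, the density increment, and the theorem (DKT §4)

Topic `Literature/Combinatorics/HalesJewett`. P. Dodos, V. Kanellopoulos, K. Tyros, *A simple
proof of the density Hales–Jewett theorem*, IMRN 2014 (= arXiv:1209.4986), §4.1 second half and
§4 (all PROVED):

* `lemma12_step`, `lemma12_iter`, `dkt_lemma12` (Lemma 12: an `(i,∗)`-insensitive set is tiled by
  pairwise disjoint `m`-dimensional subspaces up to density `2β`; the iteration keeps a splitting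
  used ⊕ free of the coordinates and the fibrewise insensitivity of the untiled part);
* `dkt_cor13` (Corollary 13: the same for `⋂_{j<r} D_j`);
* `dkt_prop6` (Proposition 6: line, or density increment `γ/2` on a `d`-dimensional subspace), with
  the DHJ witness `m₀` as a parameter so that `γ = gammaOf k m₀ δ` is monotone in `δ`;
* the standard iteration `dhj_option_iter`, `dhj_option : DHJ α → DHJ (Option α)` (given
  `GrahamRothschildLines`), the trivial base `dhj_of_card_eq_one`, invariance `dhj_of_equiv`, the
  induction `dhj_of_grahamRothschild`, `densityHalesJewett_of_grahamRothschild`, and — with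
  `GrahamRothschildLines_holds` — the DISCHARGE of the tree's named fact:
  `DensityHalesJewett_holds : DensityHalesJewett` (D-0014).

Downstream one-liners (separate files): `SzemerediTheorem_holds`
(`Combinatorics/Additive/SzemerediTheoremProofs.lean`), `GreenTao2008.SzemerediExpectation_holds`
and Green–Tao's Theorem 1.1 `exists_prime_arithmetic_progression_holds`
(`NumberTheory/Sieve/ParityWave0GreenTaoHolds.lean`).

## References
* P. Dodos, V. Kanellopoulos, K. Tyros, IMRN 2014, Lemma 12, Cor. 13, Prop. 6, §4. [cite: DodosKanellopoulosTyros2014]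
* D. H. J. Polymath, Ann. of Math. 175 (2012), Thm. 1.4. [cite: Polymath2012DHJ]
-/

open Combinatorics Finset

namespace Literature.Combinatorics.HalesJewett



/-! ### More on insensitive sets -/

/-- Insensitivity is transported along coordinate equivalences. [folklore] -/
theorem Insensitive.transport {α ι ι' : Type*} {i : α} {D : Finset (ι → Option α)}
    (h : Insensitive i D) (e : ι ≃ ι') : Insensitive i (transport e D) := by
  intro x y hxy
  rw [mem_transport, mem_transport]
  refine h _ _ ?_
  funext c
  have := congrFun hxy (e c)
  simpa [wordLine] using this

/-- Fibres (over the first block) of an insensitive set are insensitive. [folklore] -/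
theorem Insensitive.fiber {α β γ : Type*} [Fintype α] [DecidableEq α] [Fintype β] [Fintype γ]
    [DecidableEq γ] {i : α} {G : Finset (β ⊕ γ → Option α)} (h : Insensitive i G) (x : β → Option α) :
    Insensitive i (fiber G x) := by
  intro y y' hyy
  rw [mem_fiber, mem_fiber]
  refine h _ _ ?_
  funext c
  rcases c with b | c
  · rfl
  · simpa [wordLine] using congrFun hyy c

/-- Fibres over the second block of an insensitive set are insensitive. [folklore] -/
theorem Insensitive.fiberFst {α β γ : Type*} [Fintype α] [DecidableEq α] [Fintype β] [DecidableEq β]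
    [Fintype γ] {i : α} {G : Finset (β ⊕ γ → Option α)} (h : Insensitive i G)
    (z : γ → Option α) : Insensitive i (univ.filter fun x : β → Option α => Sum.elim x z ∈ G) := by
  intro y y' hyy
  simp only [mem_filter, mem_univ, true_and]
  refine h _ _ ?_
  funext c
  rcases c with b | c
  · simpa [wordLine] using congrFun hyy b
  · rfl

/-- Set differences of insensitive sets are insensitive. [folklore] -/
theorem Insensitive.sdiff {α η : Type*} [DecidableEq α] [Fintype η] {i : α}
    {D D' : Finset (η → Option α)} (h : Insensitive i D) (h' : Insensitive i D') :
    Insensitive i (D \ D') :=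
  fun x y hxy => by rw [mem_sdiff, mem_sdiff, h x y hxy, h' x y hxy]

/-- A set cut out by a family of insensitive conditions is insensitive. [folklore] -/
theorem insensitive_filter_forall {α η κ : Type*} [Fintype α] [DecidableEq α] [Fintype η] [DecidableEq η]
    {i : α} {P : κ → (η → Option α) → Prop} [∀ u x, Decidable (P u x)] [DecidablePred fun x => ∀ u, P u x]
    (h : ∀ u, Insensitive i (univ.filter (P u))) :
    Insensitive i (univ.filter fun x => ∀ u, P u x) := by
  intro x y hxy
  simp only [mem_filter, mem_univ, true_and]
  refine forall_congr' fun u => ?_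
  have := h u x y hxy
  simpa using this

/-- A set given by a predicate equivalent to membership in an insensitive set is insensitive.
[folklore] -/
theorem insensitive_filter_of_iff {α η : Type*} [Fintype α] [DecidableEq α] [Fintype η] [DecidableEq η]
    {i : α} {P : (η → Option α) → Prop} [DecidablePred P] {D : Finset (η → Option α)}
    (hD : Insensitive i D) (hP : ∀ x, P x ↔ x ∈ D) : Insensitive i (univ.filter P) := by
  intro x y hxy
  simp only [mem_filter, mem_univ, true_and, hP]
  exact hD x y hxy

/-- The empty set is insensitive. [folklore] -/
theorem insensitive_empty {α η : Type*} (i : α) : Insensitive i (∅ : Finset (η → Option α)) :=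
  fun _ _ _ => by simp

/-- `Sum.elim a b = Sum.elim c d ↔ a = c ∧ b = d`. [folklore] -/
theorem sumElim_eq_iff {β γ X : Type*} (a c : β → X) (b d : γ → X) :
    Sum.elim a b = Sum.elim c d ↔ a = c ∧ b = d := by
  constructor
  · intro h
    exact ⟨by rw [← Sum.elim_comp_inl a b, h, Sum.elim_comp_inl],
      by rw [← Sum.elim_comp_inr a b, h, Sum.elim_comp_inr]⟩
  · rintro ⟨rfl, rfl⟩; rfl

/-- Reading `∗` as `i` commutes with subspace maps: `V(u)` and `V(u^{∗→i})` are `(i,∗)`-equivalent.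
[cite: DodosKanellopoulosTyros2014, Lemma 12 (proof)] -/
theorem wordLine_subspace {α ι : Type*} {m : ℕ} (V : Subspace (Fin m) (Option α) ι)
    (u : Fin m → Option α) (i : α) : wordLine (V u) i = wordLine (V (some ∘ wordLine u i)) i := by
  funext c
  simp only [wordLine, Subspace.coe_apply]
  cases V.idxFun c with
  | inl a => rfl
  | inr e =>
    simp only [Sum.elim_inr, Function.comp_apply, wordLine]
    cases u e <;> rfl

/-- An insensitive set containing `V ↾ k` contains all of `V`. [cite: DodosKanellopoulosTyros2014, Lemma 12 (proof)] -/
theorem Insensitive.subspace_mem {α ι : Type*} [Fintype α] [DecidableEq α] [Fintype ι] {m : ℕ} {i : α}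
    {G : Finset (ι → Option α)} (hG : Insensitive i G) (V : Subspace (Fin m) (Option α) ι)
    (h : ∀ z : Fin m → α, V (some ∘ z) ∈ G) (u : Fin m → Option α) : V u ∈ G :=
  (hG _ _ (wordLine_subspace V u i)).2 (h _)

/-! ### Regrouping a three-block splitting -/

/-- The two ways of regrouping `υ ⊕ (ρ' ⊕ μ)`: `((υ ⊕ ρ') ⊕ μ)` (block `μ` last) and
`((υ ⊕ μ) ⊕ ρ')` (block `μ` joined to the used coordinates) describe the same word.
[folklore] -/
theorem regroup_eq {α ι υ ρ ρ' μ : Type*} (e : ι ≃ υ ⊕ ρ) (e₂ : ρ ≃ ρ' ⊕ μ) (w : υ → α)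
    (x : ρ' → α) (z : μ → α) :
    (Sum.elim (Sum.elim w z) x ∘
        (e.trans ((Equiv.sumCongr (Equiv.refl υ) (e₂.trans (Equiv.sumComm ρ' μ))).trans
          (Equiv.sumAssoc υ μ ρ').symm))) =
      (Sum.elim (Sum.elim w x) z ∘
        (e.trans ((Equiv.sumCongr (Equiv.refl υ) e₂).trans (Equiv.sumAssoc υ ρ' μ).symm))) := by
  funext c
  simp only [Function.comp_apply, Equiv.trans_apply]
  rcases e c with b | r
  · simp
  · simp only [Equiv.sumCongr_apply, Sum.map_inr, Equiv.trans_apply]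
    rcases e₂ r with p | q
    · simp
    · simp

/-! ### The range of a subspace -/

/-- The number of `m`-dimensional-subspace words `Fin M → (Option α ⊕ Fin m)` bounds the number of
`m`-dimensional subspaces of `(Option α)^M`: `(k+1+m)^M`. [cite: DodosKanellopoulosTyros2014, Lemma 12 (proof)] -/
theorem card_subspaceWords (α : Type*) [Fintype α] [DecidableEq α] (M m : ℕ) :
    Fintype.card (Fin M → Option α ⊕ Fin m) = (Fintype.card α + 1 + m) ^ M := by
  rw [Fintype.card_fun, Fintype.card_sum, Fintype.card_option, Fintype.card_fin, Fintype.card_fin]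

/-- The point set of a subspace has `(k+1)^m` elements. [folklore] -/
theorem card_image_subspace {α ι : Type*} [Fintype α] [DecidableEq α] [Fintype ι] [DecidableEq ι]
    {m : ℕ} (V : Subspace (Fin m) (Option α) ι) :
    #(univ.image ⇑V) = Fintype.card (Fin m → Option α) := by
  rw [card_image_of_injective _ (Subspace.injective V), card_univ]


/-! ### Families of subspaces -/

/-- The union of the point sets of a family of subspaces. [cite: DodosKanellopoulosTyros2014, Lemma 12] -/
def unionF {α ι σ : Type*} [Fintype α] [DecidableEq α] [Fintype ι] [DecidableEq ι] [Fintype σ] {m : ℕ}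
    (V : σ → Subspace (Fin m) (Option α) ι) : Finset (ι → Option α) :=
  univ.biUnion fun s => univ.image ⇑(V s)

/-- Membership in the union of a family. [folklore] -/
theorem mem_unionF {α ι σ : Type*} [Fintype α] [DecidableEq α] [Fintype ι] [DecidableEq ι] [Fintype σ]
    {m : ℕ} (V : σ → Subspace (Fin m) (Option α) ι) (x : ι → Option α) :
    x ∈ unionF V ↔ ∃ s u, V s u = x := by
  simp [unionF]

/-- Pairwise disjointness of the point sets of a family. [cite: DodosKanellopoulosTyros2014, Lemma 12] -/
def DisjointFamily {α ι σ : Type*} {m : ℕ} (V : σ → Subspace (Fin m) (Option α) ι) : Prop :=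
  ∀ s t, s ≠ t → ∀ u u', V s u ≠ V t u'

/-- The union of a disjoint family has `#σ · (k+1)^m` points. [folklore] -/
theorem card_unionF {α ι σ : Type*} [Fintype α] [DecidableEq α] [Fintype ι] [DecidableEq ι] [Fintype σ]
    {m : ℕ} (V : σ → Subspace (Fin m) (Option α) ι) (hV : DisjointFamily V) :
    #(unionF V) = Fintype.card σ * Fintype.card (Fin m → Option α) := by
  classical
  rw [unionF, card_biUnion]
  · simp only [card_image_subspace, sum_const, card_univ, smul_eq_mul]
  · intro s _ t _ hst
    rw [Function.onFun, disjoint_left]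
    intro x hx hx'
    obtain ⟨u, -, rfl⟩ := mem_image.1 hx
    obtain ⟨u', -, h⟩ := mem_image.1 hx'
    exact hV s t hst u u' h.symm

/-! ### DKT Lemma 12: one step of the tiling iteration -/

/-- **One step of the iteration in DKT Lemma 12.** Given a splitting `ι ≃ υ ⊕ ρ` (used ⊕ free
coordinates, `|ρ| ≥ M₁`), a disjoint family `V` of `m`-dimensional subspaces inside `D` with
union `U` such that every fibre of `D ∖ U` over a word on the used coordinates is
`(i,∗)`-insensitive, and `rdens(D ∖ U) ≥ 2β`, one more block of `M₁` free coordinates is used to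
add `≥ Θ = β (k+1)^m / ((k+1)^{M₁} (k+1+m)^{M₁})` worth of density of new disjoint subspaces inside
`D ∖ U`, preserving the fibrewise insensitivity. Here `M₁` is a threshold for DKT Cor. 5 at density
`β`. [cite: DodosKanellopoulosTyros2014, Lemma 12 (proof)] -/
theorem lemma12_step {α : Type} [Fintype α] [DecidableEq α] {m M₁ : ℕ} {β : ℝ} (hβ : 0 < β)
    (h5 : ∀ (ι' : Type) [Fintype ι'] [DecidableEq ι'], M₁ ≤ Fintype.card ι' →
      ∀ B : Finset (ι' → Option α), β ≤ rdens B →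
        ∃ V : Subspace (Fin m) (Option α) ι', ∀ z : Fin m → α, V (some ∘ z) ∈ B)
    {ι : Type} [Fintype ι] [DecidableEq ι] (i : α) (D : Finset (ι → Option α))
    {υ ρ : Type} [Fintype υ] [DecidableEq υ] [Fintype ρ] [DecidableEq ρ] (e : ι ≃ υ ⊕ ρ)
    (hρ : M₁ ≤ Fintype.card ρ) {σ : Type} [Fintype σ] (V : σ → Subspace (Fin m) (Option α) ι)
    (hVD : ∀ s u, V s u ∈ D) (hVdisj : DisjointFamily V)
    (hINS : ∀ w : υ → Option α, Insensitive i (fiber (transport e (D \ unionF V)) w))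
    (hdens : 2 * β ≤ rdens (D \ unionF V)) :
    ∃ (υ' ρ' : Type) (_ : Fintype υ') (_ : DecidableEq υ') (_ : Fintype ρ') (_ : DecidableEq ρ')
      (e' : ι ≃ υ' ⊕ ρ') (σ' : Type) (_ : Fintype σ') (V' : σ' → Subspace (Fin m) (Option α) ι),
      (∀ s u, V' s u ∈ D) ∧ DisjointFamily V' ∧
      (∀ w, Insensitive i (fiber (transport e' (D \ unionF V')) w)) ∧
      Fintype.card ρ = Fintype.card ρ' + M₁ ∧
      rdens (unionF V) + β * ((Fintype.card α : ℝ) + 1) ^ m /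
          (((Fintype.card α : ℝ) + 1) ^ M₁ * ((Fintype.card α : ℝ) + 1 + m) ^ M₁) ≤ rdens (unionF V') := by
  classical
  -- split off a block of `M₁` free coordinates
  obtain ⟨n', e₂, hn'⟩ := exists_equiv_sum_fin ρ hρ
  set e' : ι ≃ (υ ⊕ Fin n') ⊕ Fin M₁ :=
    e.trans ((Equiv.sumCongr (Equiv.refl υ) e₂).trans (Equiv.sumAssoc υ (Fin n') (Fin M₁)).symm) with he'
  set U : Finset (ι → Option α) := unionF V with hU
  set G : Finset (ι → Option α) := D \ U with hG
  set E : Finset ((υ ⊕ Fin n') ⊕ Fin M₁ → Option α) := transport e' G with hE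
  -- fibres of `E` are insensitive
  have hFw : ∀ w : υ → Option α, Insensitive i (transport e₂ (fiber (transport e G) w)) :=
    fun w => (hINS w).transport e₂
  have hEfib : ∀ (w : υ → Option α) (x : Fin n' → Option α),
      fiber E (Sum.elim w x) = fiber (transport e₂ (fiber (transport e G) w)) x := fun w x =>
    fiber_fiber_eq e e₂ G w x
  have hEins : ∀ p : υ ⊕ Fin n' → Option α, Insensitive i (fiber E p) := by
    intro p
    rw [← Sum.elim_comp_inl_inr p, hEfib]
    exact (hFw _).fiber _
  -- the good prefixes
  have hKp : (0 : ℝ) < Fintype.card (υ ⊕ Fin n' → Option α) := by exact_mod_cast card_cube_pos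
  have hKz : (0 : ℝ) < Fintype.card (Fin M₁ → Option α) := by exact_mod_cast card_cube_pos
  set T : Finset (υ ⊕ Fin n' → Option α) := univ.filter fun p => β ≤ rdens (fiber E p) with hT
  have hTcard : β * Fintype.card (υ ⊕ Fin n' → Option α) ≤ #T := by
    have hsum : 2 * β * #(univ : Finset (υ ⊕ Fin n' → Option α)) ≤ ∑ p, rdens (fiber E p) := by
      have h1 := rdens_eq_sum_rdens_fiber_div E
      rw [eq_div_iff hKp.ne'] at h1
      rw [card_univ, ← h1, hE, rdens_transport]
      exact mul_le_mul_of_nonneg_right hdens hKp.le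
    have := le_card_filter_of_le_sum univ (fun p => rdens (fiber E p)) (fun p _ => rdens_le_one _)
      hβ.le hsum
    rw [card_univ] at this
    convert this using 1; ring
  -- a subspace in each good fibre
  have hsub : ∀ p ∈ T, ∃ W : Subspace (Fin m) (Option α) (Fin M₁), ∀ u, W u ∈ fiber E p := by
    intro p hp
    obtain ⟨W, hW⟩ := h5 (Fin M₁) (by simp) (fiber E p) (mem_filter.1 hp).2
    exact ⟨W, (hEins p).subspace_mem W hW⟩
  -- the most popular subspace
  let f : (υ ⊕ Fin n' → Option α) → (Fin M₁ → Option α ⊕ Fin m) := fun p =>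
    if hp : p ∈ T then (Classical.choose (hsub p hp)).idxFun else fun _ => Sum.inl none
  obtain ⟨w₀, -, hw₀⟩ := exists_le_card_fiber_real T (univ : Finset (Fin M₁ → Option α ⊕ Fin m))
    univ_nonempty f (fun _ _ => mem_univ _)
  set Λ : ℝ := ((Fintype.card α : ℝ) + 1 + m) ^ M₁ with hΛ
  have hΛcard : (#(univ : Finset (Fin M₁ → Option α ⊕ Fin m)) : ℝ) = Λ := by
    rw [card_univ, card_subspaceWords]; push_cast; ring
  have hΛpos : 0 < Λ := by positivity
  set C₀ : Finset (υ ⊕ Fin n' → Option α) := T.filter fun p => f p = w₀ with hC₀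
  have hC₀card : β * Fintype.card (υ ⊕ Fin n' → Option α) / Λ ≤ #C₀ := by
    rw [hΛcard] at hw₀
    exact le_trans (by gcongr) hw₀
  have hC₀ne : C₀.Nonempty := by
    rw [← card_pos]
    have : (0 : ℝ) < #C₀ := lt_of_lt_of_le (by positivity) hC₀card
    exact_mod_cast this
  obtain ⟨p₀, hp₀⟩ := hC₀ne
  have hp₀T : p₀ ∈ T := (mem_filter.1 hp₀).1
  set V₀ : Subspace (Fin m) (Option α) (Fin M₁) := Classical.choose (hsub p₀ hp₀T) with hV₀
  have hV₀w : V₀.idxFun = w₀ := by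
    have := (mem_filter.1 hp₀).2
    simp only [f, dif_pos hp₀T] at this
    exact this
  set S : Finset (υ ⊕ Fin n' → Option α) := univ.filter fun p => ∀ u, V₀ u ∈ fiber E p with hS
  have hC₀S : C₀ ⊆ S := by
    intro p hp
    have hpT : p ∈ T := (mem_filter.1 hp).1
    have hfp : f p = w₀ := (mem_filter.1 hp).2
    simp only [f, dif_pos hpT] at hfp
    have heq : Classical.choose (hsub p hpT) = V₀ := Subspace.ext (by rw [hfp, hV₀w])
    refine mem_filter.2 ⟨mem_univ _, fun u => ?_⟩
    have := Classical.choose_spec (hsub p hpT) u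
    rwa [heq] at this
  have hScard : β * Fintype.card (υ ⊕ Fin n' → Option α) / Λ ≤ #S :=
    hC₀card.trans (by exact_mod_cast card_le_card hC₀S)
  -- the new subspaces
  set Wn : S → Subspace (Fin m) (Option α) ι := fun p => subspaceReindex (Subspace.vert (p : υ ⊕ Fin n' → Option α) V₀) e'.symm
    with hWn
  have hWpt : ∀ (p : S) u, ⇑(Wn p) u = Sum.elim (p : υ ⊕ Fin n' → Option α) (V₀ u) ∘ e' := by
    intro p u
    rw [hWn]; simp only []
    rw [subspaceReindex_apply, Equiv.symm_symm, Subspace.vert_apply]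
  have hWG : ∀ (p : S) u, ⇑(Wn p) u ∈ G := by
    intro p u
    have hp := (mem_filter.1 p.2).2 u
    rw [mem_fiber, hE, mem_transport] at hp
    rwa [hWpt]
  set V' : σ ⊕ S → Subspace (Fin m) (Option α) ι := fun s => Sum.elim V Wn s with hV'
  have hV'D : ∀ s u, V' s u ∈ D := by
    rintro (s | p) u
    · exact hVD s u
    · exact (mem_sdiff.1 (hWG p u)).1
  have hnew_old : ∀ (p : S) u s u', ⇑(Wn p) u ≠ V s u' := by
    intro p u s u' h
    have h1 := hWG p u
    rw [h, hG, mem_sdiff] at h1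
    exact h1.2 ((mem_unionF V _).2 ⟨s, u', rfl⟩)
  have hnew_new : ∀ (p q : S), p ≠ q → ∀ u u', ⇑(Wn p) u ≠ ⇑(Wn q) u' := by
    intro p q hpq u u' h
    rw [hWpt, hWpt] at h
    have h2 : Sum.elim (p : υ ⊕ Fin n' → Option α) (V₀ u) = Sum.elim (q : υ ⊕ Fin n' → Option α) (V₀ u') := by
      have := congrArg (fun g => g ∘ e'.symm) h
      simpa [Function.comp_assoc] using this
    have h3 := congrArg (fun g => g ∘ Sum.inl) h2
    simp only [Sum.elim_comp_inl] at h3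
    exact hpq (Subtype.ext h3)
  have hV'disj : DisjointFamily V' := by
    rintro (s | p) (t | q) hst u u'
    · exact hVdisj s t (fun h => hst (by rw [h])) u u'
    · exact fun h => hnew_old q u' s u h.symm
    · exact hnew_old p u t u'
    · exact hnew_new p q (fun h => hst (by rw [h])) u u'
  -- the new union
  set Unew : Finset (ι → Option α) := unionF Wn with hUnew
  have hUsub : U ⊆ unionF V' := by
    intro x hx
    obtain ⟨s, u, rfl⟩ := (mem_unionF V x).1 hx
    exact (mem_unionF V' _).2 ⟨Sum.inl s, u, rfl⟩
  have hUnewsub : Unew ⊆ unionF V' := by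
    intro x hx
    obtain ⟨p, u, rfl⟩ := (mem_unionF Wn x).1 hx
    exact (mem_unionF V' _).2 ⟨Sum.inr p, u, rfl⟩
  have hUdisj : Disjoint U Unew := by
    rw [disjoint_left]
    intro x hx hx'
    obtain ⟨s, u, rfl⟩ := (mem_unionF V x).1 hx
    obtain ⟨p, u', h⟩ := (mem_unionF Wn _).1 hx'
    exact hnew_old p u' s u h
  have hUnew_card : (#Unew : ℝ) = #S * Fintype.card (Fin m → Option α) := by
    rw [hUnew, card_unionF Wn (fun p q hpq u u' => hnew_new p q hpq u u'), Fintype.card_coe]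
    push_cast; ring
  -- the new splitting and the insensitivity invariant
  set e'' : ι ≃ (υ ⊕ Fin M₁) ⊕ Fin n' :=
    e.trans ((Equiv.sumCongr (Equiv.refl υ) (e₂.trans (Equiv.sumComm (Fin n') (Fin M₁)))).trans
      (Equiv.sumAssoc υ (Fin M₁) (Fin n')).symm) with he''
  have hmemV' : ∀ y : ι → Option α, y ∈ unionF V' ↔ y ∈ U ∨ y ∈ Unew := by
    intro y
    rw [mem_unionF, mem_unionF, mem_unionF]
    constructor
    · rintro ⟨s | p, u, h⟩
      · exact Or.inl ⟨s, u, h⟩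
      · exact Or.inr ⟨p, u, h⟩
    · rintro (⟨s, u, h⟩ | ⟨p, u, h⟩)
      · exact ⟨Sum.inl s, u, h⟩
      · exact ⟨Sum.inr p, u, h⟩
  have hINS' : ∀ w' : υ ⊕ Fin M₁ → Option α,
      Insensitive i (fiber (transport e'' (D \ unionF V')) w') := by
    intro w'
    set w : υ → Option α := w' ∘ Sum.inl with hw
    set z : Fin M₁ → Option α := w' ∘ Sum.inr with hz
    have hw' : w' = Sum.elim w z := (Sum.elim_comp_inl_inr w').symm
    -- `S₁`: the old fibre, `S₂`: the new subspaces
    have hS₁ : Insensitive i (univ.filter fun x : Fin n' → Option α =>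
        Sum.elim x z ∈ transport e₂ (fiber (transport e G) w)) := (hFw w).fiberFst z
    have hSx : Insensitive i (univ.filter fun x : Fin n' → Option α =>
        ∀ u, Sum.elim x (V₀ u) ∈ transport e₂ (fiber (transport e G) w)) :=
      insensitive_filter_forall fun u => (hFw w).fiberFst (V₀ u)
    have hS₂ : Insensitive i (univ.filter fun x : Fin n' → Option α =>
        (∃ u, V₀ u = z) ∧ ∀ u, Sum.elim x (V₀ u) ∈ transport e₂ (fiber (transport e G) w)) := by
      by_cases hzV : ∃ u, V₀ u = z
      · refine insensitive_filter_of_iff hSx fun x => ?_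
        simp only [mem_filter, mem_univ, true_and, hzV]
      · refine insensitive_filter_of_iff (insensitive_empty i) fun x => ?_
        simp only [hzV, false_and, notMem_empty]
    have hD12 := hS₁.sdiff hS₂
    -- identify the fibre with `S₁ ∖ S₂`
    rw [fiber]
    refine insensitive_filter_of_iff hD12 fun x => ?_
    have hregroup : Sum.elim w' x ∘ e'' = Sum.elim (Sum.elim w x) z ∘ e' := by
      rw [hw']; exact regroup_eq e e₂ w x z
    set y : ι → Option α := Sum.elim (Sum.elim w x) z ∘ e' with hy
    -- part 1: the old fibre
    have h1 : y ∈ G ↔ Sum.elim x z ∈ transport e₂ (fiber (transport e G) w) := by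
      rw [hy, ← mem_transport, ← hE, ← mem_fiber, hEfib, mem_fiber]
    -- part 2: the new subspaces
    have h2 : y ∈ Unew ↔
        (∃ u, V₀ u = z) ∧ ∀ u, Sum.elim x (V₀ u) ∈ transport e₂ (fiber (transport e G) w) := by
      rw [hUnew, mem_unionF]
      constructor
      · rintro ⟨p, u, hpu⟩
        rw [hWpt, hy, e'.surjective.injective_comp_right.eq_iff, sumElim_eq_iff] at hpu
        obtain ⟨hp1, hp2⟩ := hpu
        refine ⟨⟨u, hp2⟩, fun u' => ?_⟩
        have := (mem_filter.1 p.2).2 u'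
        rw [hp1, hEfib, mem_fiber] at this
        exact this
      · rintro ⟨⟨u, hu⟩, hall⟩
        have hmem : Sum.elim w x ∈ S := by
          refine mem_filter.2 ⟨mem_univ _, fun u' => ?_⟩
          rw [hEfib, mem_fiber]; exact hall u'
        refine ⟨⟨Sum.elim w x, hmem⟩, u, ?_⟩
        rw [hWpt, hu]
    rw [mem_transport, hregroup]
    change y ∈ D \ unionF V' ↔ _
    rw [mem_sdiff, hmemV', not_or, mem_sdiff, mem_filter, mem_filter]
    simp only [mem_univ, true_and]
    rw [← h2, ← h1, hG, mem_sdiff]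
    exact and_assoc.symm
  -- the density gain
  have hKι : (Fintype.card (ι → Option α) : ℝ) =
      Fintype.card (υ ⊕ Fin n' → Option α) * ((Fintype.card α : ℝ) + 1) ^ M₁ := by
    rw [Fintype.card_fun, Fintype.card_fun, Fintype.card_option, Fintype.card_congr e,
      Fintype.card_sum, Fintype.card_sum, Fintype.card_fin, ← hn']
    push_cast; ring
  have hKm : (Fintype.card (Fin m → Option α) : ℝ) = ((Fintype.card α : ℝ) + 1) ^ m := by
    rw [Fintype.card_fun, Fintype.card_option, Fintype.card_fin]; push_cast; ring
  have hKιpos : (0 : ℝ) < Fintype.card (ι → Option α) := by exact_mod_cast card_cube_pos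
  refine ⟨υ ⊕ Fin M₁, Fin n', inferInstance, inferInstance, inferInstance, inferInstance, e'', σ ⊕ S,
    inferInstance, V', hV'D, hV'disj, hINS', by rw [Fintype.card_fin]; omega, ?_⟩
  have hcard : (#U : ℝ) + #Unew ≤ #(unionF V') := by
    have := card_union_of_disjoint hUdisj
    have h2 : #(U ∪ Unew) ≤ #(unionF V') := card_le_card (union_subset hUsub hUnewsub)
    exact_mod_cast (by omega : #U + #Unew ≤ #(unionF V'))
  rw [rdens_def, rdens_def, div_add' _ _ _ hKιpos.ne', div_le_div_iff_of_pos_right hKιpos]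
  refine le_trans ?_ hcard
  rw [hUnew_card, hKm]
  have hgain : β * ((Fintype.card α : ℝ) + 1) ^ m /
      (((Fintype.card α : ℝ) + 1) ^ M₁ * ((Fintype.card α : ℝ) + 1 + m) ^ M₁) * Fintype.card (ι → Option α)
      ≤ #S * ((Fintype.card α : ℝ) + 1) ^ m := by
    rw [hKι, ← hΛ]
    have hk1pos : (0 : ℝ) < ((Fintype.card α : ℝ) + 1) ^ M₁ := by positivity
    calc β * ((Fintype.card α : ℝ) + 1) ^ m / (((Fintype.card α : ℝ) + 1) ^ M₁ * Λ) *
          (Fintype.card (υ ⊕ Fin n' → Option α) * ((Fintype.card α : ℝ) + 1) ^ M₁)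
        = (β * Fintype.card (υ ⊕ Fin n' → Option α) / Λ) * ((Fintype.card α : ℝ) + 1) ^ m := by
          field_simp
      _ ≤ #S * ((Fintype.card α : ℝ) + 1) ^ m := by gcongr
  linarith


/-- Pullbacks of insensitive sets along subspaces are insensitive. [cite: DodosKanellopoulosTyros2014, Corollary 13 (proof)] -/
theorem Insensitive.pullback {α ι : Type*} [Fintype α] [DecidableEq α] [Fintype ι] {m : ℕ} {i : α}
    {D : Finset (ι → Option α)} (hD : Insensitive i D) (V : Subspace (Fin m) (Option α) ι) :
    Insensitive i (univ.filter fun u : Fin m → Option α => V u ∈ D) := by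
  intro u u' huu
  simp only [mem_filter, mem_univ, true_and]
  refine hD _ _ ?_
  rw [wordLine_subspace V u i, wordLine_subspace V u' i, huu]

/-- **The iteration of DKT Lemma 12.** [cite: DodosKanellopoulosTyros2014, Lemma 12 (proof)] -/
theorem lemma12_iter {α : Type} [Fintype α] [DecidableEq α] {m M₁ : ℕ} {β : ℝ} (hβ : 0 < β)
    (h5 : ∀ (ι' : Type) [Fintype ι'] [DecidableEq ι'], M₁ ≤ Fintype.card ι' →
      ∀ B : Finset (ι' → Option α), β ≤ rdens B →
        ∃ V : Subspace (Fin m) (Option α) ι', ∀ z : Fin m → α, V (some ∘ z) ∈ B)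
    {ι : Type} [Fintype ι] [DecidableEq ι] (i : α) (D : Finset (ι → Option α)) (hD : Insensitive i D) :
    ∀ J : ℕ, J * M₁ ≤ Fintype.card ι →
      (∃ (σ : Type) (_ : Fintype σ) (V : σ → Subspace (Fin m) (Option α) ι),
        (∀ s u, V s u ∈ D) ∧ DisjointFamily V ∧ rdens (D \ unionF V) < 2 * β) ∨
      (∃ (υ ρ : Type) (_ : Fintype υ) (_ : DecidableEq υ) (_ : Fintype ρ) (_ : DecidableEq ρ)
        (e : ι ≃ υ ⊕ ρ) (σ : Type) (_ : Fintype σ) (V : σ → Subspace (Fin m) (Option α) ι),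
        (∀ s u, V s u ∈ D) ∧ DisjointFamily V ∧
        (∀ w, Insensitive i (fiber (transport e (D \ unionF V)) w)) ∧
        Fintype.card ι ≤ Fintype.card ρ + J * M₁ ∧
        (J : ℝ) * (β * ((Fintype.card α : ℝ) + 1) ^ m /
          (((Fintype.card α : ℝ) + 1) ^ M₁ * ((Fintype.card α : ℝ) + 1 + m) ^ M₁)) ≤ rdens (unionF V)) := by
  classical
  intro J
  induction J with
  | zero =>
    intro _
    right
    refine ⟨Empty, ι, inferInstance, inferInstance, inferInstance, inferInstance,
      (Equiv.emptySum Empty ι).symm, Empty, inferInstance, fun s => s.elim, fun s => s.elim,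
      fun s => s.elim, fun w => ?_, by simp, ?_⟩
    · have hU : unionF (fun s : Empty => (s.elim : Subspace (Fin m) (Option α) ι)) = ∅ := by
        ext x; simp [unionF]
      rw [hU, sdiff_empty]
      exact (hD.transport _).fiber w
    · rw [Nat.cast_zero, zero_mul]; exact rdens_nonneg _
  | succ J ih =>
    intro hJ
    have hJ' : J * M₁ ≤ Fintype.card ι := le_trans (Nat.mul_le_mul_right _ (Nat.le_succ J)) hJ
    rcases ih hJ' with hdone | ⟨υ, ρ, _, _, _, _, e, σ, _, V, hVD, hVdisj, hINS, hcard, hdens⟩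
    · exact Or.inl hdone
    by_cases hsmall : rdens (D \ unionF V) < 2 * β
    · exact Or.inl ⟨σ, inferInstance, V, hVD, hVdisj, hsmall⟩
    right
    push Not at hsmall
    have hρ : M₁ ≤ Fintype.card ρ := by
      have : (J + 1) * M₁ = J * M₁ + M₁ := by ring
      omega
    obtain ⟨υ', ρ', _, _, _, _, e', σ', _, V', hV'D, hV'disj, hINS', hcard', hdens'⟩ :=
      lemma12_step hβ h5 i D e hρ V hVD hVdisj hINS hsmall
    refine ⟨υ', ρ', inferInstance, inferInstance, inferInstance, inferInstance, e', σ', inferInstance,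
      V', hV'D, hV'disj, hINS', ?_, ?_⟩
    · have : (J + 1) * M₁ = J * M₁ + M₁ := by ring
      omega
    · push_cast
      linarith

/-- **DKT Lemma 12.** Assume `DHJ α` (`k = |α| ≥ 1`), `m ≥ 1`, `β > 0`. Then for all large `ι`, every
`(i,∗)`-insensitive `D ⊆ (Option α)^ι` contains a family of pairwise disjoint `m`-dimensional
combinatorial subspaces covering all of `D` but a set of density `< 2β`. (DKT assume
`rdens D ≥ 2β`; without it the empty family works, so the hypothesis is dropped.)
[cite: DodosKanellopoulosTyros2014, Lemma 12] -/
theorem dkt_lemma12 {α : Type} [Fintype α] [DecidableEq α] (hk : 1 ≤ Fintype.card α) (h : DHJ α)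
    {m : ℕ} (hm : 1 ≤ m) {β : ℝ} (hβ : 0 < β) :
    ∃ F : ℕ, ∀ (ι : Type) [Fintype ι] [DecidableEq ι], F ≤ Fintype.card ι →
      ∀ (i : α) (D : Finset (ι → Option α)), Insensitive i D →
        ∃ (σ : Type) (_ : Fintype σ) (V : σ → Subspace (Fin m) (Option α) ι),
          (∀ s u, V s u ∈ D) ∧ DisjointFamily V ∧ rdens (D \ unionF V) < 2 * β := by
  obtain ⟨M₁, h5⟩ := mdhjStar_of_dhj hk h hm hβ
  set Θ : ℝ := β * ((Fintype.card α : ℝ) + 1) ^ m /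
    (((Fintype.card α : ℝ) + 1) ^ M₁ * ((Fintype.card α : ℝ) + 1 + m) ^ M₁) with hΘ
  have hΘpos : 0 < Θ := by positivity
  set J : ℕ := ⌊1 / Θ⌋₊ + 2 with hJ
  refine ⟨J * M₁, fun ι _ _ hι i D hD => ?_⟩
  rcases lemma12_iter hβ h5 i D hD J hι with hdone | ⟨υ, ρ, _, _, _, _, e, σ, _, V, -, -, -, -, hdens⟩
  · exact hdone
  · exfalso
    have h1 : rdens (unionF V) ≤ 1 := rdens_le_one _
    have h2 : (1 : ℝ) < J * Θ := by
      have hJgt : 1 / Θ < J := by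
        rw [hJ]; push_cast
        have := Nat.lt_floor_add_one (1 / Θ)
        linarith
      calc (1 : ℝ) = 1 / Θ * Θ := by field_simp
        _ < J * Θ := mul_lt_mul_of_pos_right hJgt hΘpos
    linarith

/-! ### DKT Corollary 13 -/

/-- **DKT Corollary 13.** Assume `DHJ α`, `m ≥ 1`, `β > 0`, `r ≥ 1`. For all large `ι`: if
`D_j` (`j < r`) are subsets of `(Option α)^ι` with `D_j` `(i_j,∗)`-insensitive, then
`D = ⋂_j D_j` contains a family of pairwise disjoint `m`-dimensional subspaces covering all of
`D` but a set of density `< 2rβ`. [cite: DodosKanellopoulosTyros2014, Corollary 13] -/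
theorem dkt_cor13 {α : Type} [Fintype α] [DecidableEq α] (hk : 1 ≤ Fintype.card α) (h : DHJ α)
    {β : ℝ} (hβ : 0 < β) :
    ∀ r : ℕ, 1 ≤ r → ∀ m : ℕ, 1 ≤ m →
      ∃ F : ℕ, ∀ (ι : Type) [Fintype ι] [DecidableEq ι], F ≤ Fintype.card ι →
        ∀ (idx : Fin r → α) (Ds : Fin r → Finset (ι → Option α)), (∀ j, Insensitive (idx j) (Ds j)) →
          ∃ (σ : Type) (_ : Fintype σ) (V : σ → Subspace (Fin m) (Option α) ι),
            (∀ s u j, V s u ∈ Ds j) ∧ DisjointFamily V ∧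
            rdens ((univ.filter fun x => ∀ j, x ∈ Ds j) \ unionF V) < 2 * r * β := by
  classical
  intro r hr
  induction r, hr using Nat.le_induction with
  | base =>
    intro m hm
    obtain ⟨F, hF⟩ := dkt_lemma12 hk h hm hβ
    refine ⟨F, fun ι _ _ hι idx Ds hDs => ?_⟩
    obtain ⟨σ, _, V, hVD, hVdisj, hdens⟩ := hF ι hι (idx 0) (Ds 0) (hDs 0)
    refine ⟨σ, inferInstance, V, fun s u j => ?_, hVdisj, ?_⟩
    · rw [Subsingleton.elim j 0]; exact hVD s u
    · have : (univ.filter fun x : ι → Option α => ∀ j : Fin 1, x ∈ Ds j) = Ds 0 := by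
        ext x
        simp only [mem_filter, mem_univ, true_and]
        constructor
        · intro hx; exact hx 0
        · intro hx j; rwa [Subsingleton.elim j 0]
      rw [this]; push_cast; linarith
  | succ r hr ih =>
    intro m hm
    obtain ⟨F12, h12⟩ := dkt_lemma12 hk h hm hβ
    set m' : ℕ := max F12 1 with hm'
    obtain ⟨F, hF⟩ := ih m' (le_max_right _ _)
    refine ⟨F, fun ι _ _ hι idx Ds hDs => ?_⟩
    -- the first `r` sets
    obtain ⟨σ₁, _, V₁, hV₁D, hV₁disj, hdens₁⟩ :=
      hF ι hι (idx ∘ Fin.castSucc) (Ds ∘ Fin.castSucc) (fun j => hDs _)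
    -- inside each member, tile the pullback of the last set
    set ilast : α := idx (Fin.last r) with hilast
    set Dlast : Finset (ι → Option α) := Ds (Fin.last r) with hDlast
    have hB : ∀ s : σ₁, ∃ (τ : Type) (_ : Fintype τ) (W : τ → Subspace (Fin m) (Option α) (Fin m')),
        (∀ t u, W t u ∈ univ.filter fun u : Fin m' → Option α => V₁ s u ∈ Dlast) ∧ DisjointFamily W ∧
        rdens ((univ.filter fun u : Fin m' → Option α => V₁ s u ∈ Dlast) \ unionF W) < 2 * β :=
      fun s => h12 (Fin m') (by simp [hm']) ilast _ ((hDs (Fin.last r)).pullback (V₁ s))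
    choose τ hτ W hWB hWdisj hWdens using hB
    letI : ∀ s, Fintype (τ s) := hτ
    set V : (Σ s, τ s) → Subspace (Fin m) (Option α) ι := fun st => Subspace.comp (V₁ st.1) (W st.1 st.2)
      with hV
    refine ⟨(Σ s, τ s), inferInstance, V, ?_, ?_, ?_⟩
    · -- inside every `Ds j`
      rintro ⟨s, t⟩ u j
      rw [hV]; simp only [Subspace.comp_apply]
      refine Fin.lastCases ?_ (fun j' => ?_) j
      · exact (mem_filter.1 (hWB s t u)).2
      · exact hV₁D s _ j'
    · -- pairwise disjoint
      rintro ⟨s, t⟩ ⟨s', t'⟩ hne u u' heq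
      rw [hV] at heq; simp only [Subspace.comp_apply] at heq
      by_cases hs : s = s'
      · subst hs
        have ht : t ≠ t' := fun h => hne (by subst h; rfl)
        exact hWdisj s t t' ht u u' (Subspace.injective (V₁ s) heq)
      · exact hV₁disj s s' hs _ _ heq
    · -- density of the uncovered part
      have hKι : (0 : ℝ) < Fintype.card (ι → Option α) := by exact_mod_cast card_cube_pos
      have hKm' : (0 : ℝ) < Fintype.card (Fin m' → Option α) := by exact_mod_cast card_cube_pos
      set D' : Finset (ι → Option α) := univ.filter fun x => ∀ j : Fin r, x ∈ (Ds ∘ Fin.castSucc) j with hD'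
      set Dall : Finset (ι → Option α) := univ.filter fun x => ∀ j : Fin (r + 1), x ∈ Ds j with hDall
      set R : σ₁ → Finset (Fin m' → Option α) := fun s =>
        (univ.filter fun u : Fin m' → Option α => V₁ s u ∈ Dlast) \ unionF (W s) with hR
      have hcover : Dall \ unionF V ⊆ (D' \ unionF V₁) ∪ univ.biUnion fun s => (R s).image ⇑(V₁ s) := by
        intro x hx
        rw [mem_sdiff] at hx
        obtain ⟨hxD, hxU⟩ := hx
        have hxall := (mem_filter.1 hxD).2
        by_cases hx₁ : x ∈ unionF V₁
        · obtain ⟨s, u, rfl⟩ := (mem_unionF V₁ x).1 hx₁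
          refine mem_union_right _ (mem_biUnion.2 ⟨s, mem_univ _, mem_image.2 ⟨u, ?_, rfl⟩⟩)
          rw [hR, mem_sdiff]
          refine ⟨mem_filter.2 ⟨mem_univ _, hxall (Fin.last r)⟩, fun hu => hxU ?_⟩
          obtain ⟨t, u', hu'⟩ := (mem_unionF (W s) u).1 hu
          exact (mem_unionF V _).2 ⟨⟨s, t⟩, u', by rw [hV]; simp only [Subspace.comp_apply, hu']⟩
        · refine mem_union_left _ (mem_sdiff.2 ⟨mem_filter.2 ⟨mem_univ _, fun j => hxall _⟩, hx₁⟩)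
      have hRcard : ∀ s, (#(R s) : ℝ) ≤ 2 * β * Fintype.card (Fin m' → Option α) := by
        intro s
        have := hWdens s
        rw [rdens_def, div_lt_iff₀ hKm'] at this
        rw [hR]
        simp only []
        exact this.le
      have hU₁card : (#(unionF V₁) : ℝ) = Fintype.card σ₁ * Fintype.card (Fin m' → Option α) := by
        exact_mod_cast card_unionF V₁ hV₁disj
      have hU₁le : (#(unionF V₁) : ℝ) ≤ Fintype.card (ι → Option α) := by
        exact_mod_cast card_le_univ _
      have h1 : (#(Dall \ unionF V) : ℝ) ≤ #(D' \ unionF V₁) + ∑ s, (#(R s) : ℝ) := by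
        have := card_le_card hcover
        have h2 := card_union_le (D' \ unionF V₁) (univ.biUnion fun s => (R s).image ⇑(V₁ s))
        have h3 : #(univ.biUnion fun s => (R s).image ⇑(V₁ s)) ≤ ∑ s, #(R s) :=
          card_biUnion_le.trans (sum_le_sum fun s _ => card_image_le)
        exact_mod_cast this.trans (h2.trans (Nat.add_le_add_left h3 _))
      have h4 : ∑ s, (#(R s) : ℝ) ≤ 2 * β * Fintype.card (ι → Option α) := by
        calc ∑ s, (#(R s) : ℝ) ≤ ∑ _s : σ₁, 2 * β * Fintype.card (Fin m' → Option α) := sum_le_sum fun s _ => hRcard s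
          _ = 2 * β * (Fintype.card σ₁ * Fintype.card (Fin m' → Option α)) := by
              rw [sum_const, card_univ, nsmul_eq_mul]; ring
          _ ≤ 2 * β * Fintype.card (ι → Option α) := by rw [← hU₁card]; gcongr
      have h5' : (#(D' \ unionF V₁) : ℝ) < 2 * r * β * Fintype.card (ι → Option α) := by
        rw [rdens_def, div_lt_iff₀ hKι] at hdens₁; exact hdens₁
      rw [rdens_def, div_lt_iff₀ hKι]
      push_cast
      nlinarith [h1, h4, h5']




/-! ### The numerical invariants (e1) of DKT, for fixed `k` and `m₀` -/

/-- `θ = (δ/4)/((k+1)^{m₀} - k^{m₀})`. [cite: DodosKanellopoulosTyros2014, (4.1)] -/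
noncomputable def thetaOf (k m₀ : ℕ) (δ : ℝ) : ℝ := (δ / 4) / (((k : ℝ) + 1) ^ m₀ - (k : ℝ) ^ m₀)

/-- `η = δ θ / 48`. [cite: DodosKanellopoulosTyros2014, (4.1)] -/
noncomputable def etaOf (k m₀ : ℕ) (δ : ℝ) : ℝ := δ * thetaOf k m₀ δ / 48

/-- `γ = δ η² / (2k)` (DKT: `δ η²/k`). [cite: DodosKanellopoulosTyros2014, (4.1)] -/
noncomputable def gammaOf (k m₀ : ℕ) (δ : ℝ) : ℝ := δ * (etaOf k m₀ δ) ^ 2 / (2 * k)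

/-- The denominator `(k+1)^{m₀} - k^{m₀} ≥ 1` for `m₀ ≥ 1`. [folklore] -/
theorem one_le_linesDen (k : ℕ) {m₀ : ℕ} (hm₀ : 1 ≤ m₀) :
    (1 : ℝ) ≤ ((k : ℝ) + 1) ^ m₀ - (k : ℝ) ^ m₀ := by
  have h : (k : ℝ) ^ m₀ + 1 ≤ ((k : ℝ) + 1) ^ m₀ := by
    have hk : (0 : ℝ) ≤ k := Nat.cast_nonneg k
    obtain ⟨m, rfl⟩ : ∃ m, m₀ = m + 1 := ⟨m₀ - 1, by omega⟩
    have h1 : (k : ℝ) ^ (m + 1) ≤ ((k : ℝ) + 1) ^ m * k := by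
      rw [pow_succ]; gcongr; linarith
    have h2 : (1 : ℝ) ≤ ((k : ℝ) + 1) ^ m := one_le_pow₀ (by linarith)
    calc (k : ℝ) ^ (m + 1) + 1 ≤ ((k : ℝ) + 1) ^ m * k + ((k : ℝ) + 1) ^ m := by linarith
      _ = ((k : ℝ) + 1) ^ (m + 1) := by ring
  linarith

/-- Basic bounds: `0 < θ ≤ δ/4`. [folklore] -/
theorem thetaOf_pos_le (k : ℕ) {m₀ : ℕ} (hm₀ : 1 ≤ m₀) {δ : ℝ} (hδ : 0 < δ) :
    0 < thetaOf k m₀ δ ∧ thetaOf k m₀ δ ≤ δ / 4 := by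
  have hW := one_le_linesDen k hm₀
  unfold thetaOf
  refine ⟨div_pos (by linarith) (by linarith), ?_⟩
  rw [div_le_iff₀ (by linarith)]
  nlinarith

/-- Monotonicity of `γ` in `δ` (for fixed `k`, `m₀`). [folklore] -/
theorem gammaOf_mono (k : ℕ) {m₀ : ℕ} (hm₀ : 1 ≤ m₀) {δ δ' : ℝ} (hδ : 0 ≤ δ) (h : δ ≤ δ') :
    gammaOf k m₀ δ ≤ gammaOf k m₀ δ' := by
  have hW := one_le_linesDen k hm₀
  unfold gammaOf etaOf thetaOf
  have hδ' : 0 ≤ δ' := le_trans hδ h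
  have e : ∀ x : ℝ, x * (x * (x / 4 / (((k : ℝ) + 1) ^ m₀ - (k : ℝ) ^ m₀)) / 48) ^ 2 / (2 * k) =
      x ^ 5 * (1 / ((4 * (((k : ℝ) + 1) ^ m₀ - (k : ℝ) ^ m₀) * 48) ^ 2 * (2 * k))) := by
    intro x
    field_simp
  rw [e, e]
  refine mul_le_mul_of_nonneg_right (pow_le_pow_left₀ hδ h 5) ?_
  positivity

/-- `γ > 0` for `δ > 0`, `k ≥ 1`. [folklore] -/
theorem gammaOf_pos {k : ℕ} (hk : 1 ≤ k) {m₀ : ℕ} (hm₀ : 1 ≤ m₀) {δ : ℝ} (hδ : 0 < δ) :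
    0 < gammaOf k m₀ δ := by
  have := (thetaOf_pos_le k hm₀ hδ).1
  unfold gammaOf etaOf
  have hk' : (0 : ℝ) < k := by exact_mod_cast hk
  positivity

/-! ### DKT Proposition 6 -/

/-- Counting through a subspace: the points of `V` in `B` are counted by the pullback.
[folklore] -/
theorem card_filter_subspace_mem {α ι : Type*} [Fintype α] [DecidableEq α] [Fintype ι] [DecidableEq ι]
    {d : ℕ} (V : Subspace (Fin d) (Option α) ι) (B : Finset (ι → Option α)) :
    #(univ.filter fun u : Fin d → Option α => V u ∈ B) = #(B ∩ univ.image ⇑V) := by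
  rw [← card_image_of_injective _ (Subspace.injective V)]
  congr 1
  ext y
  simp only [mem_image, mem_filter, mem_univ, true_and, mem_inter]
  constructor
  · rintro ⟨u, hu, rfl⟩; exact ⟨hu, u, rfl⟩
  · rintro ⟨hy, u, rfl⟩; exact ⟨u, hy, rfl⟩

/-- Existence of `m` with `k^m ≤ η (k+1)^m` beyond any given bound. [folklore] -/
theorem exists_pow_ratio_le (k : ℕ) {η : ℝ} (hη : 0 < η) (M : ℕ) :
    ∃ m : ℕ, M ≤ m ∧ (k : ℝ) ^ m ≤ η * ((k : ℝ) + 1) ^ m := by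
  have hq : (k : ℝ) / ((k : ℝ) + 1) < 1 := by
    rw [div_lt_one (by positivity)]; linarith
  have hq0 : 0 ≤ (k : ℝ) / ((k : ℝ) + 1) := by positivity
  obtain ⟨n, hn⟩ := exists_pow_lt_of_lt_one hη hq
  refine ⟨max n M, le_max_right _ _, ?_⟩
  have h1 : ((k : ℝ) / ((k : ℝ) + 1)) ^ (max n M) ≤ η :=
    (pow_le_pow_of_le_one hq0 hq.le (le_max_left _ _)).trans hn.le
  have hpos : (0 : ℝ) < ((k : ℝ) + 1) ^ (max n M) := by positivity
  rw [div_pow, div_le_iff₀ hpos] at h1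
  exact h1

/-- **DKT Proposition 6** (the dichotomy), with the DHJ witness `m₀` for `α` at density `δ/4`
as a parameter (so that the increment `γ/2`, `γ = gammaOf k m₀ δ`, is monotone in `δ`): for all
large `ι`, a set `A ⊆ (Option α)^ι` of density `≥ δ` either contains a combinatorial line or has
density `≥ δ + γ/2` inside some `d`-dimensional combinatorial subspace.
[cite: DodosKanellopoulosTyros2014, Proposition 6] -/
theorem dkt_prop6 {α : Type} [Fintype α] [DecidableEq α] (hk : 1 ≤ Fintype.card α) (h : DHJ α)
    (hGR : GrahamRothschildLines) {δ : ℝ} (hδ : 0 < δ) (hδ1 : δ ≤ 1) {m₀ : ℕ} (hm₀ : 1 ≤ m₀)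
    (hDHJ : ∀ (ι : Type) [Fintype ι] [DecidableEq ι], m₀ ≤ Fintype.card ι →
      ∀ B : Finset (ι → α), δ / 4 ≤ rdens B → ∃ l : Line α ι, ∀ a, l a ∈ B)
    {d : ℕ} (hd : 1 ≤ d) :
    ∃ N : ℕ, ∀ (ι : Type) [Fintype ι] [DecidableEq ι], N ≤ Fintype.card ι →
      ∀ A : Finset (ι → Option α), δ ≤ rdens A →
        (∃ l : Line (Option α) ι, ∀ a, l a ∈ A) ∨
        ∃ V : Subspace (Fin d) (Option α) ι, δ + gammaOf (Fintype.card α) m₀ δ / 2 ≤ densIn V A := by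
  classical
  haveI : Nonempty α := Fintype.card_pos_iff.1 (by omega)
  set k : ℕ := Fintype.card α with hkdef
  set θ : ℝ := thetaOf k m₀ δ with hθdef
  set η : ℝ := etaOf k m₀ δ with hηdef
  set γ : ℝ := gammaOf k m₀ δ with hγdef
  obtain ⟨hθpos, hθle⟩ := thetaOf_pos_le k hm₀ hδ
  have hθ1 : θ ≤ 1 := by linarith
  have hηeq : η = δ * θ / 48 := rfl
  have hη : 0 < η := by rw [hηeq]; positivity
  have hη2 : η ≤ 1 / 2 := by rw [hηeq]; nlinarith
  have hηδ : η ^ 2 ≤ δ := by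
    have h1 : η ≤ δ := by rw [hηeq]; nlinarith
    have h2 : η ≤ 1 := by linarith
    nlinarith
  have h48 : 48 * η ≤ δ * θ := by rw [hηeq]; linarith
  have hηθ : η < θ / 2 := by rw [hηeq]; nlinarith
  have hkpos : (0 : ℝ) < k := by rw [hkdef]; exact_mod_cast (by omega : 0 < Fintype.card α)
  have hγpos : 0 < γ := gammaOf_pos hk hm₀ hδ
  have hγeq : γ = δ * η ^ 2 / (2 * k) := rfl
  -- the tiling threshold (Cor. 13 with `r = k`, `β = γ²/(4k)`) and the dimension `m`
  set β : ℝ := γ ^ 2 / (4 * k) with hβ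
  have hβpos : 0 < β := by positivity
  obtain ⟨F13, h13⟩ := dkt_cor13 hk h hβpos k hk d hd
  obtain ⟨m, hmge, hkm⟩ := exists_pow_ratio_le k hη (max m₀ F13)
  have hm₀m : m₀ ≤ m := le_trans (le_max_left _ _) hmge
  have hF13m : F13 ≤ m := le_trans (le_max_right _ _) hmge
  obtain ⟨N, hN⟩ := dkt_cor11 hk hGR hδ hδ1 hm₀ hDHJ hm₀m hη hη2 hηδ hθ1 h48 hηθ hkm
  refine ⟨N, fun ι _ _ hι A hA => ?_⟩
  by_cases hline : ∃ l : Line (Option α) ι, ∀ a, l a ∈ A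
  · exact Or.inl hline
  right
  obtain ⟨W, D, hDins, hDd, hAD⟩ := hN ι hι A hA hline
  -- tile `D = ⋂ D_i` by `d`-dimensional subspaces of `(Option α)^m`
  set σα : Fin k ≃ α := (Fintype.equivFin α).symm with hσα
  obtain ⟨τ, _, Vs, hVsD, hVsdisj, hVsdens⟩ :=
    h13 (Fin m) (by simp [hF13m]) (fun j => σα j) (fun j => D (σα j)) (fun j => hDins _)
  set Dcap : Finset (Fin m → Option α) := univ.filter fun x => ∀ i, x ∈ D i with hDcap
  have hDcap' : (univ.filter fun x : Fin m → Option α => ∀ j : Fin k, x ∈ D (σα j)) = Dcap := by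
    ext x
    simp only [mem_filter, mem_univ, true_and, hDcap]
    constructor
    · intro hx i; simpa [hσα] using hx (σα.symm i)
    · intro hx j; exact hx _
  rw [hDcap'] at hVsdens
  set U : Finset (Fin m → Option α) := unionF Vs with hU
  set AW : Finset (Fin m → Option α) := traceIn W A with hAW
  have hKm : (0 : ℝ) < Fintype.card (Fin m → Option α) := by exact_mod_cast card_cube_pos
  have hKd : (0 : ℝ) < Fintype.card (Fin d → Option α) := by exact_mod_cast card_cube_pos
  have hUsub : U ⊆ Dcap := by
    intro x hx
    obtain ⟨t, u, rfl⟩ := (mem_unionF Vs x).1 hx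
    exact mem_filter.2 ⟨mem_univ _, fun i => by simpa [hσα] using hVsD t u (σα.symm i)⟩
  -- the counting: `(δ + γ/2) #U ≤ #(A_W ∩ U)`
  have hβk : 2 * (k : ℝ) * β = γ ^ 2 / 2 := by rw [hβ]; field_simp; ring
  have hDU : (#(Dcap \ U) : ℝ) < γ ^ 2 / 2 * Fintype.card (Fin m → Option α) := by
    have := hVsdens
    rw [rdens_def, div_lt_iff₀ hKm, hβk] at this
    exact this
  have hDcard : γ * Fintype.card (Fin m → Option α) ≤ #Dcap := by
    rw [rdens_def, le_div_iff₀ hKm] at hDd; exact hDd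
  have hADcard : (δ + γ) * #Dcap ≤ #(AW ∩ Dcap) := by
    have := hAD
    rw [rdens_def, rdens_def, ← mul_div_assoc, div_le_div_iff_of_pos_right hKm] at this
    exact this
  have hAU : (#(AW ∩ Dcap) : ℝ) ≤ #(AW ∩ U) + #(Dcap \ U) := by
    have : AW ∩ Dcap ⊆ (AW ∩ U) ∪ (Dcap \ U) := by
      intro x hx
      rw [mem_inter] at hx
      by_cases hxU : x ∈ U
      · exact mem_union_left _ (mem_inter.2 ⟨hx.1, hxU⟩)
      · exact mem_union_right _ (mem_sdiff.2 ⟨hx.2, hxU⟩)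
    exact_mod_cast (card_le_card this).trans (card_union_le _ _)
  have hUcard : (#U : ℝ) ≤ #Dcap := by exact_mod_cast card_le_card hUsub
  have s1 : γ ^ 2 / 2 * (Fintype.card (Fin m → Option α) : ℝ) ≤ γ / 2 * #Dcap := by
    have := mul_le_mul_of_nonneg_left hDcard (by positivity : (0 : ℝ) ≤ γ / 2)
    linarith
  have s2 : (δ + γ / 2) * (#U : ℝ) ≤ (δ + γ / 2) * #Dcap :=
    mul_le_mul_of_nonneg_left hUcard (by positivity)
  have hmain : (δ + γ / 2) * #U ≤ #(AW ∩ U) := by linarith [hDU.le]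
  have hγ1 : γ ≤ 1 := by
    have h1 := cor11_num1 (k := (k : ℝ)) hη hδ1 (by exact_mod_cast hk)
    rw [← hγeq] at h1
    have h2 : η ^ 2 ≤ 1 := pow_le_one₀ hη.le (by linarith)
    linarith
  have hUpos : (0 : ℝ) < #U := by
    have h1 : (#Dcap : ℝ) ≤ #U + #(Dcap \ U) := by
      have := card_le_card_sdiff_add_card (s := Dcap) (t := U)
      rw [add_comm]; exact_mod_cast this
    have hγsq : γ ^ 2 ≤ γ := by rw [sq]; exact mul_le_of_le_one_left hγpos.le hγ1
    have s3 : γ ^ 2 / 2 * (Fintype.card (Fin m → Option α) : ℝ) ≤ γ / 2 * Fintype.card (Fin m → Option α) :=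
      mul_le_mul_of_nonneg_right (by linarith) hKm.le
    have s4 : (0 : ℝ) < γ / 2 * Fintype.card (Fin m → Option α) := by positivity
    linarith [hDU, hDcard, h1, s3, s4]
  -- pick the best subspace of the family
  haveI : Nonempty τ := by
    by_contra hτ
    rw [not_nonempty_iff] at hτ
    have : U = ∅ := by
      rw [hU, unionF]; ext x; simp
    rw [this, card_empty, Nat.cast_zero] at hUpos
    exact lt_irrefl _ hUpos
  have hsumU : ∑ t, (#(univ.image ⇑(Vs t)) : ℝ) = #U := by
    rw [hU, card_unionF Vs hVsdisj]
    simp only [card_image_subspace, sum_const, card_univ, nsmul_eq_mul]; push_cast; ring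
  have hsumA : ∑ t, (#(AW ∩ univ.image ⇑(Vs t)) : ℝ) = #(AW ∩ U) := by
    have : AW ∩ U = univ.biUnion fun t => AW ∩ univ.image ⇑(Vs t) := by
      rw [hU, unionF, inter_biUnion]
    rw [this, card_biUnion]
    · push_cast; rfl
    · intro s _ t _ hst
      rw [Function.onFun, disjoint_left]
      intro x hx hx'
      obtain ⟨u, -, hu⟩ := mem_image.1 (mem_inter.1 hx).2
      obtain ⟨u', -, hu'⟩ := mem_image.1 (mem_inter.1 hx').2
      exact hVsdisj s t hst u u' (hu.trans hu'.symm)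
  obtain ⟨t, -, ht⟩ : ∃ t ∈ (univ : Finset τ),
      (δ + γ / 2) * #(univ.image ⇑(Vs t)) ≤ (#(AW ∩ univ.image ⇑(Vs t)) : ℝ) := by
    refine exists_le_of_sum_le univ_nonempty ?_
    rw [← mul_sum, hsumU, hsumA]
    exact hmain
  refine ⟨Subspace.comp W (Vs t), ?_⟩
  rw [densIn, rdens_def, le_div_iff₀ hKd]
  have hcnt : #(univ.filter fun u : Fin d → Option α => ⇑(Subspace.comp W (Vs t)) u ∈ A) =
      #(AW ∩ univ.image ⇑(Vs t)) := by
    rw [← card_filter_subspace_mem (Vs t) AW]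
    congr 1
    ext u
    simp only [mem_filter, mem_univ, true_and, Subspace.comp_apply, hAW, traceIn]
  rw [hcnt, ← card_image_subspace (Vs t)]
  convert ht using 2


/-! ### The density increment: `DHJ α → DHJ (Option α)` -/

/-- A set of density `≥ 1` is everything, hence contains a line (if there is a coordinate).
[folklore] -/
theorem exists_line_of_dens_ge_one {α ι : Type*} [Fintype α] [DecidableEq α] [Nonempty α] [Fintype ι]
    [DecidableEq ι] [Nonempty ι] (A : Finset (ι → α)) (hA : 1 ≤ rdens A) : ∃ l : Line α ι, ∀ a, l a ∈ A := by
  have hK : (0 : ℝ) < Fintype.card (ι → α) := by exact_mod_cast card_cube_pos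
  have hcard : Fintype.card (ι → α) ≤ #A := by
    rw [rdens_def, le_div_iff₀ hK, one_mul] at hA; exact_mod_cast hA
  have hAu : A = univ := eq_univ_of_card A (le_antisymm (card_le_univ A) hcard)
  exact ⟨Line.diagonal α ι, fun a => by rw [hAu]; exact mem_univ _⟩

/-- Pulling a line back through a subspace: if the pullback of `A` along `V` contains the line `L`
then `A` contains `V ∘ L`. [folklore] -/
theorem exists_line_of_pullback {α ι : Type*} {d : ℕ} (V : Subspace (Fin d) α ι) (A : Finset (ι → α))
    {L : Line α (Fin d)} (hL : ∀ a, V (L a) ∈ A) : ∃ l : Line α ι, ∀ a, l a ∈ A :=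
  ⟨Subspace.line V L, fun a => by rw [Subspace.line_apply]; exact hL a⟩

/-- **The density increment iteration (DKT: "a standard iteration").** With `γ₀ = gammaOf k m₀ δ`:
for every `J`, sets of density `≥ max(δ, 1 - J γ₀/2)` in `(Option α)^ι`, `ι` large, contain a
combinatorial line. [cite: DodosKanellopoulosTyros2014, Section 4 (proof of Theorem 1 from Proposition 6)] -/
theorem dhj_option_iter {α : Type} [Fintype α] [DecidableEq α] (hk : 1 ≤ Fintype.card α) (h : DHJ α)
    (hGR : GrahamRothschildLines) {δ : ℝ} (hδ : 0 < δ) {m₀ : ℕ} (hm₀ : 1 ≤ m₀)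
    (hDHJ : ∀ (ι : Type) [Fintype ι] [DecidableEq ι], m₀ ≤ Fintype.card ι →
      ∀ B : Finset (ι → α), δ / 4 ≤ rdens B → ∃ l : Line α ι, ∀ a, l a ∈ B) :
    ∀ J : ℕ, ∃ N : ℕ, ∀ (ι : Type) [Fintype ι] [DecidableEq ι], N ≤ Fintype.card ι →
      ∀ A : Finset (ι → Option α), max δ (1 - J * (gammaOf (Fintype.card α) m₀ δ / 2)) ≤ rdens A →
        ∃ l : Line (Option α) ι, ∀ a, l a ∈ A := by
  set γ₀ : ℝ := gammaOf (Fintype.card α) m₀ δ with hγ₀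
  intro J
  induction J with
  | zero =>
    refine ⟨1, fun ι _ _ hι A hA => ?_⟩
    haveI : Nonempty ι := Fintype.card_pos_iff.1 (by omega)
    refine exists_line_of_dens_ge_one A ?_
    have := le_max_right δ (1 - (0 : ℕ) * (γ₀ / 2))
    push_cast at this hA
    linarith
  | succ J ih =>
    obtain ⟨NJ, hNJ⟩ := ih
    set δ' : ℝ := max δ (1 - (J + 1 : ℕ) * (γ₀ / 2)) with hδ'
    have hδδ' : δ ≤ δ' := le_max_left _ _
    have hδ'pos : 0 < δ' := lt_of_lt_of_le hδ hδδ'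
    by_cases hδ'1 : δ' ≤ 1
    · -- Proposition 6 at density `δ'` (with the same `m₀`) in dimension `d = max NJ 1`
      have hDHJ' : ∀ (ι : Type) [Fintype ι] [DecidableEq ι], m₀ ≤ Fintype.card ι →
          ∀ B : Finset (ι → α), δ' / 4 ≤ rdens B → ∃ l : Line α ι, ∀ a, l a ∈ B :=
        fun ι _ _ hι B hB => hDHJ ι hι B (by linarith)
      obtain ⟨N, hN⟩ := dkt_prop6 hk h hGR hδ'pos hδ'1 hm₀ hDHJ' (d := max NJ 1) (le_max_right _ _)
      refine ⟨N, fun ι _ _ hι A hA => ?_⟩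
      rcases hN ι hι A hA with hline | ⟨V, hV⟩
      · exact hline
      · have hmono : γ₀ ≤ gammaOf (Fintype.card α) m₀ δ' := gammaOf_mono _ hm₀ hδ.le hδδ'
        have hpull : max δ (1 - (J : ℕ) * (γ₀ / 2)) ≤
            rdens (univ.filter fun u : Fin (max NJ 1) → Option α => V u ∈ A) := by
          have hdens : δ' + γ₀ / 2 ≤ rdens (univ.filter fun u : Fin (max NJ 1) → Option α => V u ∈ A) := by
            have : densIn V A = rdens (univ.filter fun u : Fin (max NJ 1) → Option α => V u ∈ A) := rfl
            linarith
          refine le_trans (max_le ?_ ?_) hdens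
          · linarith [hγ₀ ▸ (gammaOf_pos hk hm₀ hδ)]
          · have := le_max_right δ (1 - (J + 1 : ℕ) * (γ₀ / 2))
            rw [← hδ'] at this
            push_cast at this ⊢
            linarith
        obtain ⟨L, hL⟩ := hNJ (Fin (max NJ 1)) (by simp) _ hpull
        exact exists_line_of_pullback V A (fun a => (mem_filter.1 (hL a)).2)
    · -- density `> 1` is impossible
      refine ⟨0, fun ι _ _ _ A hA => ?_⟩
      exfalso
      have := rdens_le_one A
      push Not at hδ'1
      linarith

/-- **The inductive step of the density Hales–Jewett theorem (DKT §4): `DHJ_k ⇒ DHJ_{k+1}`**,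
conditionally on the Graham–Rothschild fact. [cite: DodosKanellopoulosTyros2014, Theorem 1 (proof, Section 4)] -/
theorem dhj_option {α : Type} [Fintype α] [DecidableEq α] (hk : 1 ≤ Fintype.card α) (h : DHJ α)
    (hGR : GrahamRothschildLines) : DHJ (Option α) := by
  intro δ hδ
  by_cases hδ1 : δ ≤ 1
  · obtain ⟨M, hM⟩ := h (δ / 4) (by positivity)
    set m₀ : ℕ := max M 1 with hm₀
    have hDHJ : ∀ (ι : Type) [Fintype ι] [DecidableEq ι], m₀ ≤ Fintype.card ι →
        ∀ B : Finset (ι → α), δ / 4 ≤ rdens B → ∃ l : Line α ι, ∀ a, l a ∈ B :=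
      fun ι _ _ hι B hB => hM ι (le_trans (le_max_left _ _) hι) B hB
    set γ₀ : ℝ := gammaOf (Fintype.card α) m₀ δ with hγ₀
    have hγ₀pos : 0 < γ₀ := gammaOf_pos hk (le_max_right _ _) hδ
    set J : ℕ := ⌈2 / γ₀⌉₊ with hJ
    obtain ⟨N, hN⟩ := dhj_option_iter hk h hGR hδ (le_max_right _ _) hDHJ J
    refine ⟨N, fun ι _ _ hι A hA => hN ι hι A (le_trans (max_le le_rfl ?_) hA)⟩
    have h1 : 2 / γ₀ ≤ J := Nat.le_ceil _
    have h2 : 1 ≤ (J : ℝ) * (γ₀ / 2) := by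
      rw [div_le_iff₀ hγ₀pos] at h1; linarith
    linarith
  · refine ⟨0, fun ι _ _ _ A hA => ?_⟩
    exfalso
    have := rdens_le_one A
    push Not at hδ1
    linarith

/-! ### Base case, induction on the alphabet, and the theorem -/

/-- `DHJ` for a one-letter alphabet: the cube has one point. [folklore] -/
theorem dhj_of_card_eq_one {α : Type} [Fintype α] [DecidableEq α] (h1 : Fintype.card α = 1) : DHJ α := by
  intro δ hδ
  refine ⟨1, fun ι _ _ hι A hA => ?_⟩
  haveI : Nonempty ι := Fintype.card_pos_iff.1 (by omega)
  haveI : Nonempty α := Fintype.card_pos_iff.1 (by omega)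
  have hsub : Subsingleton (ι → α) := by
    have : Subsingleton α := Fintype.card_le_one_iff_subsingleton.1 h1.le
    infer_instance
  have hAne : A.Nonempty := by
    rw [← card_pos]
    have hK : (0 : ℝ) < Fintype.card (ι → α) := by exact_mod_cast card_cube_pos
    have : (0 : ℝ) < #A := by
      rw [rdens_def, le_div_iff₀ hK] at hA
      nlinarith
    exact_mod_cast this
  obtain ⟨x₀, hx₀⟩ := hAne
  exact ⟨Line.diagonal α ι, fun a => by rw [Subsingleton.elim (⇑(Line.diagonal α ι) a) x₀]; exact hx₀⟩

/-- `DHJ` is invariant under renaming the alphabet. [folklore] -/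
theorem dhj_of_equiv {α α' : Type} [Fintype α] [DecidableEq α] [Fintype α'] [DecidableEq α']
    (e : α ≃ α') (h : DHJ α) : DHJ α' := by
  intro δ hδ
  obtain ⟨N, hN⟩ := h δ hδ
  refine ⟨N, fun ι _ _ hι A hA => ?_⟩
  classical
  set B : Finset (ι → α) := A.map ⟨fun w => e.symm ∘ w, fun w w' hw => by
    funext i; simpa using congrFun hw i⟩ with hB
  have hBd : δ ≤ rdens B := by
    have : rdens B = rdens A := by
      rw [rdens_def, rdens_def, hB, card_map, Fintype.card_fun, Fintype.card_fun, Fintype.card_congr e]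
    rwa [this]
  obtain ⟨l, hl⟩ := hN ι hι B hBd
  refine ⟨l.map e, fun a' => ?_⟩
  have := hl (e.symm a')
  rw [hB, mem_map] at this
  obtain ⟨w, hw, hw'⟩ := this
  have hlw : ⇑l (e.symm a') = e.symm ∘ w := hw'.symm
  have : ⇑(l.map e) a' = w := by
    have h1 := Line.map_apply e l (e.symm a')
    rw [Equiv.apply_symm_apply] at h1
    rw [h1, hlw]
    funext i; simp
  rw [this]; exact hw

/-- **The density Hales–Jewett theorem for every finite alphabet, from the Graham–Rothschild
fact**, by induction on `k = |α| ≥ 1` (DKT §4; base `k = 1` trivial).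
[cite: DodosKanellopoulosTyros2014, Theorem 1] -/
theorem dhj_of_grahamRothschild (hGR : GrahamRothschildLines) :
    ∀ (k : ℕ), 1 ≤ k → ∀ (α : Type) [Fintype α] [DecidableEq α], Fintype.card α = k → DHJ α := by
  intro k hk
  induction k, hk using Nat.le_induction with
  | base => intro α _ _ h1; exact dhj_of_card_eq_one h1
  | succ k hk ih =>
    intro α _ _ hcard
    classical
    haveI : Nonempty α := Fintype.card_pos_iff.1 (by omega)
    obtain ⟨a₀⟩ := (inferInstance : Nonempty α)
    have hsub : Fintype.card {b // b ≠ a₀} = k := by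
      rw [Fintype.card_subtype_compl, Fintype.card_subtype_eq, hcard]; omega
    have h1 : DHJ {b // b ≠ a₀} := ih _ hsub
    have h2 : DHJ (Option {b // b ≠ a₀}) := dhj_option (by omega) h1 hGR
    exact dhj_of_equiv (Equiv.optionSubtypeNe a₀) h2

/-- **The density Hales–Jewett theorem (the tree's named fact `DensityHalesJewett`, Polymath 2012
Thm. 1.4 / Furstenberg–Katznelson 1991 Thm. E) from the Graham–Rothschild fact**, via
Dodos–Kanellopoulos–Tyros 2014. [cite: DodosKanellopoulosTyros2014, Theorem 1] -/
theorem densityHalesJewett_of_grahamRothschild (hGR : GrahamRothschildLines) : DensityHalesJewett :=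
  densityHalesJewett_of_dhj fun k hk => dhj_of_grahamRothschild hGR k hk (Fin k) (by simp)


/-- **The density Hales–Jewett theorem** (Furstenberg–Katznelson 1991; the tree's named fact
`DensityHalesJewett`, Polymath 2012 Thm. 1.4) — DISCHARGED: Dodos–Kanellopoulos–Tyros's proof with
the Graham–Rothschild theorem for lines proved in `DKTGrahamRothschildProof.lean`.
[cite: DodosKanellopoulosTyros2014, Theorem 1] -/
theorem DensityHalesJewett_holds : DensityHalesJewett :=
  densityHalesJewett_of_grahamRothschild GrahamRothschildLines_holds

end Literature.Combinatorics.HalesJewett
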